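import Literature.AlgebraicGeometry.Frobenioids.PullbackLinearSquares
import Literature.AlgebraicGeometry.Frobenioids.FrobeniusConjugates
import HarnessLib

/-!
# Frobenioids I, Proposition 1.11 (vii): co-angular pre-steps are FSM-morphisms

Mochizuki, *The geometry of Frobenioids I: the general theory*, Kyushu J. Math. **62** (2008)
293–400, §1, Proposition 1.11 (vii) and its proof, kurims text pp. 37–38
[cite: MochizukiFrdI2008, Prop. 1.11(vii)]. Standing data: `C → F_Φ` a Frobenioid (`hF`).

> "(vii) Let `φ : A → B` be a co-angular pre-step; `ε : C → B` a morphism. Then there exists a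
> co-angular pre-step `γ : D → C` and a morphism `α : D → A` such that `ε ∘ γ = φ ∘ α`. In
> particular, every co-angular pre-step of `C` is an FSM-morphism."

PROVED along the printed proof (p. 38): "we may assume without loss of generality that `ε` is a
pull-back morphism, an isometric pre-step, a co-angular pre-step, or a morphism of Frobenius type"
(the square property is stable under composition of the `ε`'s and every `ε` factors through these
four kinds by Def. 1.3 (iv)(a), (v)(b)); the four cases are, respectively, Prop. 1.11 (v)
["pulling back the zero divisor of `φ` via `ε`"], the construction of Prop. 1.9 (ii), the slice
equivalence of Def. 1.3 (iii)(d), and Prop. 1.10 (ii) followed by Def. 1.3 (iii)(d). Fiberwise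
surjectivity of a co-angular pre-step is then the square property, and it is a monomorphism by
Def. 1.3 (v)(a). No statement of the paper is strengthened.
-/

namespace Literature.AlgebraicGeometry.Frobenioids

open CategoryTheory Opposite

universe w v v' u u'

namespace PreFrobenioid

variable {D : Type u} [Category.{v} D] {Φ : Dᵒᵖ ⥤ CommMonCat.{w}}
  {C : Type u'} [Category.{v'} C] {F : C ⥤ ElemFrobenioid Φ}

/-- The square property of Prop. 1.11 (vii) for an arrow `ε : X → B`: every co-angular pre-step
`φ : A → B` admits a co-angular pre-step `γ : W → X` and an arrow `α : W → A` with
`ε ∘ γ = φ ∘ α`. [cite: MochizukiFrdI2008, Prop. 1.11(vii) p.37] -/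
def HasCoAngularSquares (F : C ⥤ ElemFrobenioid Φ) {X B : C} (ε : X ⟶ B) : Prop :=
  ∀ ⦃A : C⦄ (φ : A ⟶ B), IsCoAngularPreStep F φ →
    ∃ (W : C) (γ : W ⟶ X) (α : W ⟶ A), IsCoAngularPreStep F γ ∧ γ ≫ ε = α ≫ φ

/-- The square property is stable under composition of the `ε`'s.
[cite: MochizukiFrdI2008, Prop. 1.11(vii) p.38] -/
theorem HasCoAngularSquares.comp {X Y B : C} {ε₁ : X ⟶ Y} {ε₂ : Y ⟶ B}
    (h₁ : HasCoAngularSquares F ε₁) (h₂ : HasCoAngularSquares F ε₂) :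
    HasCoAngularSquares F (ε₁ ≫ ε₂) := by
  intro A φ hφ
  obtain ⟨W₂, γ₂, α₂, hγ₂, hsq₂⟩ := h₂ φ hφ
  obtain ⟨W₁, γ₁, α₁, hγ₁, hsq₁⟩ := h₁ γ₂ hγ₂
  refine ⟨W₁, γ₁, α₁ ≫ α₂, hγ₁, ?_⟩
  rw [← Category.assoc, hsq₁, Category.assoc, hsq₂, Category.assoc]

/-- Case 1: `ε` a pull-back morphism ("by 'pulling back the zero divisor of `φ` via `ε`' — cf.
assertion (v)"). [cite: MochizukiFrdI2008, Prop. 1.11(vii) p.38] -/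
theorem hasCoAngularSquares_of_isPullbackMorphism (hF : IsFrobenioid F) {X B : C} {ε : X ⟶ B}
    (hε : IsPullbackMorphism F ε) : HasCoAngularSquares F ε := by
  intro A φ hφ
  obtain ⟨W, γ, hγ, hγx⟩ := hF.iii_d_over_surj X (pull Φ (Base F ε) (invDiv F φ hφ.2.2))
  obtain ⟨ψ, -, hsq⟩ := exists_pullback_square_over hF hε γ φ hγ hφ hγx
  exact ⟨W, γ, ψ, hγ, hsq.symm⟩

/-- Case 2: `ε` an isometric pre-step ("follows formally from the equivalence of categories of
Proposition 1.9, (ii) [induced by `φ`]"). [cite: MochizukiFrdI2008, Prop. 1.11(vii) p.38] -/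
theorem hasCoAngularSquares_of_isIsometricPreStep (hF : IsFrobenioid F) {X B : C} {ε : X ⟶ B}
    (hε : IsIsometricPreStep F ε) : HasCoAngularSquares F ε := by
  intro A φ hφ
  obtain ⟨W, ψ₀, α₀, hψ₀, -, hsq, -⟩ := exists_square_of_isCoAngularPreStep hF φ hφ ε hε
  exact ⟨W, ψ₀, α₀, hψ₀, hsq⟩

/-- Case 3: `ε` a co-angular pre-step ("from the second equivalence of categories of
Definition 1.3, (iii), (d)": take a co-angular pre-step over `B` with
`(−^*)⁻¹ Div = (φ^*)⁻¹ Div φ · (ε^*)⁻¹ Div ε`). [cite: MochizukiFrdI2008, Prop. 1.11(vii) p.38] -/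
theorem hasCoAngularSquares_of_isCoAngularPreStep (hF : IsFrobenioid F) {X B : C} {ε : X ⟶ B}
    (hε : IsCoAngularPreStep F ε) : HasCoAngularSquares F ε := by
  intro A φ hφ
  obtain ⟨W, ω, hω, hωx⟩ := hF.iii_d_over_surj B (invDiv F φ hφ.2.2 * invDiv F ε hε.2.2)
  obtain ⟨γ, hγ, hγω⟩ := hF.iii_d_over_full ω ε hω hε ⟨invDiv F φ hφ.2.2, by rw [hωx, mul_comm]⟩
  obtain ⟨α, -, hαω⟩ := hF.iii_d_over_full ω φ hω hφ ⟨invDiv F ε hε.2.2, by rw [hωx]⟩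
  exact ⟨W, γ, α, hγ, by rw [hγω, hαω]⟩

/-- Case 4: `ε` of Frobenius type (take `γ` with `(γ^*)⁻¹ Div γ = ε^* (φ^*)⁻¹ Div φ`, swap
`ε ∘ γ = γ' ∘ ε'` by Prop. 1.10 (ii); then `(γ'^*)⁻¹ Div γ' = d · (φ^*)⁻¹ Div φ`, so `γ'` factors
through `φ` by Def. 1.3 (iii)(d)). [cite: MochizukiFrdI2008, Prop. 1.11(vii) p.38] -/
theorem hasCoAngularSquares_of_isFrobeniusType (hF : IsFrobenioid F) {X B : C} {ε : X ⟶ B}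
    (hε : IsFrobeniusType F ε) : HasCoAngularSquares F ε := by
  have hP := hF.isPreFrobenioid
  intro A φ hφ
  haveI : IsIso (Base F φ) := hφ.2.2
  obtain ⟨W, γ, hγ, hγx⟩ := hF.iii_d_over_surj X (pull Φ (Base F ε) (invDiv F φ hφ.2.2))
  haveI : IsIso (Base F γ) := hγ.2.2
  -- swap: `γ ≫ ε = ε' ≫ γ'`
  obtain ⟨W', ε', γ', hε', hγ'pre, hsq, -, hDγ'⟩ := exists_frobeniusType_preStep_swap hF γ hγ.2 ε hε
  have hγ'co : IsCoAngular F γ' :=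
    IsCoAngular.frobeniusConjugate hF hγ.1 hsq hε' hε (by
      have := congrArg (degFr F) hsq
      rw [degFr_comp, degFr_comp, show degFr F γ = 1 from hγ.2.1, show degFr F γ' = 1 from hγ'pre.1,
        one_mul, mul_one] at this
      exact this)
  have hγ' : IsCoAngularPreStep F γ' := ⟨hγ'co, hγ'pre⟩
  haveI : IsIso (Base F γ') := hγ'.2.2
  haveI : IsIso (Base F ε') := hε'.2
  -- `(γ'^*)⁻¹ Div γ' = ((φ^*)⁻¹ Div φ) ^ d`
  have hbase : Base F γ ≫ Base F ε = Base F ε' ≫ Base F γ' := by rw [← base_comp, ← hsq, base_comp]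
  have hDγ : Div F γ = pull Φ (Base F ε' ≫ Base F γ') (invDiv F φ hφ.2.2) := by
    rw [← hbase, pull_comp, ← hγx, pull_invDiv]
  have hinv : invDiv F γ' hγ'.2.2 = (invDiv F φ hφ.2.2) ^ (degFr F ε : ℕ) := by
    show pull Φ (inv (Base F γ')) (Div F γ') = _
    rw [hDγ', hDγ, ← pull_comp, IsIso.inv_hom_id_assoc, map_pow, ← pull_comp, IsIso.inv_hom_id,
      pull_id]
  have hdvd : invDiv F φ hφ.2.2 ∣ invDiv F γ' hγ'.2.2 := by
    rw [hinv]
    exact dvd_pow_self _ (PNat.ne_zero _)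
  obtain ⟨α', -, hα'⟩ := hF.iii_d_over_full γ' φ hγ' hφ hdvd
  exact ⟨W, γ, ε' ≫ α', hγ, by rw [Category.assoc, hα', hsq]⟩

/-- **Prop. 1.11 (vii)**: for a co-angular pre-step `φ : A → B` and any `ε : X → B` there are a
co-angular pre-step `γ : W → X` and an arrow `α : W → A` with `ε ∘ γ = φ ∘ α` (factor
`ε` by Def. 1.3 (iv)(a) and (v)(b) and apply the four cases).
[cite: MochizukiFrdI2008, Prop. 1.11(vii) p.37] -/
theorem hasCoAngularSquares (hF : IsFrobenioid F) {X B : C} (ε : X ⟶ B) : HasCoAngularSquares F ε := by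
  obtain ⟨X₁, Y₁, f, p, q, hfac, hf, hp, hq⟩ := hF.iv_a_exists ε
  obtain ⟨X₂, c, i, hci, hc, hi⟩ := hF.v_b_exists p hp
  rw [← hfac, ← hci]
  exact (hasCoAngularSquares_of_isFrobeniusType hF hf).comp
    (((hasCoAngularSquares_of_isCoAngularPreStep hF hc).comp
      (hasCoAngularSquares_of_isIsometricPreStep hF hi)).comp
      (hasCoAngularSquares_of_isPullbackMorphism hF hq))

/-- **Prop. 1.11 (vii)**, restated: the square itself. [cite: MochizukiFrdI2008, Prop. 1.11(vii) p.37] -/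
theorem exists_coAngular_square (hF : IsFrobenioid F) {A B X : C} (φ : A ⟶ B)
    (hφ : IsCoAngularPreStep F φ) (ε : X ⟶ B) :
    ∃ (W : C) (γ : W ⟶ X) (α : W ⟶ A), IsCoAngularPreStep F γ ∧ γ ≫ ε = α ≫ φ :=
  hasCoAngularSquares hF ε φ hφ

/-- **Prop. 1.11 (vii)**, "In particular, every co-angular pre-step of `C` is an FSM-morphism"
(fiberwise surjective by the square property; a monomorphism by Def. 1.3 (v)(a)).
[cite: MochizukiFrdI2008, Prop. 1.11(vii) p.37] -/
theorem IsCoAngularPreStep.isFSM (hF : IsFrobenioid F) {A B : C} {φ : A ⟶ B}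
    (hφ : IsCoAngularPreStep F φ) : IsFSM φ := by
  refine ⟨fun X ε => ?_, hF.v_a φ hφ.2⟩
  obtain ⟨W, γ, α, -, hsq⟩ := exists_coAngular_square hF φ hφ ε
  exact ⟨W, α, γ, hsq.symm⟩

end PreFrobenioid

end Literature.AlgebraicGeometry.Frobenioids
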